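import Summits.BirchSwinnertonDyer.Rank1Residual.F1Sign2.RMGenusSumAtTwo
import HarnessLib

/-!
# Cell `bsd-f1-sign2` — kernel bookkeeping for the -an MEMO-an §25 port (`F1Sign2/RMGenusSumAtTwo.lean`, AN-39)

No new named fact, no `sorry`; ns `…F1Sign2.ANg22` as the statement file; typer -ty g18.  Contents: (1) -an's one proved reduction `minimalRMGenusSum_exponents_zero`
(Sketch_g22 622a8640800b1e46 l.244–258 VERBATIM — AN-39e ⇐ AN-39c₂ once both Heegner points HAVE exponents; moved here from the statement file because a Theorems-side file
holding a proof must stay ≤ 400 lines, `lint.statement-form`); (2) REF1 g18 §201's BC7 KERNEL CERTIFICATES from `HOME/REF1-data/b201/lean/Probe201.lean` b3431c39b55fe87b l.422–528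
VERBATIM (ns `…ANg22.REF1s201` → `…ANg22`; farm rc 0 · exactly 12 probe sorries — not ported — · axioms std): (K1a/b/c) `bc7_int_div_neg_seven_two`, `bc7_int_div_six_four`,
`bc7_odd_sq_div_four` (the `Int`-division semantics behind R201d: `B / κ` is E-rounding, junk when `κ ∤ B`; for ODD `n`, `n²/4 = k(k+1)` is EVEN); (K2a/b/c) `bc7_two_pow_odd_inj`
(uniqueness of `2^a·odd`), `bc7_exponent_clash` (AN-39c₂'s conclusion for `(m₁,m₂)` and `(m₁+1,m₂+1)` at one `Σ` is contradictory), `bc7_exponent_clash_sha` (shift by 2: the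
`Ш(E)[2^∞] = 4` regime); (K3) `bc7_sha_clash` (AN-39c/h's exact constants against the Ш-corrected identity force `n₁n₂ = 0`); (K4) **`twiceDatum`** (a `def`: the DOUBLED
parametrisation datum `(c, deg) ↦ (2c, 4·deg)` for the SAME `W, f, L, uniformize`, degree bookkeeping taken as the hypothesis `hdeg`), `twiceDatum_c`, `twiceDatum_φ`
(`φ′ = 2 • φ`) and **`heegnerPointComplex_twiceDatum : heegnerPointComplex (twiceDatum Dt hdeg) H = 2 • heegnerPointComplex Dt H`** — THE KERNEL WITNESS (J1) that
`ModularParametrizationData` does not pin the Heegner point's 2-divisibility, i.e. WHY R201a's binder `IsOptimalDatum Dt →` (or the tree's AN-27 `¬ (2:ℤ) ∣ Dt.c`) is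
load-bearing in AN-39c₂′/e′ (applied in the statement file).  Because (K4) declares a `def`, this kernel is filed `--kind statement`.  BSD is not proved by this; no item closed;
PARTITION none.  bears_on: stmt-BirchSwinnertonDyer-23715.
-/

namespace Summit.BirchSwinnertonDyer.Rank1Residual.F1Sign2.ANg22

open Literature.NumberTheory.EllipticCurves Literature.NumberTheory.EllipticCurves.ModularForms UpperHalfPlane
open Summit.BirchSwinnertonDyer.Rank1Residual.F1Sign2 Summit.BirchSwinnertonDyer.Rank1Residual.F1Sign2.ANg16
open Summit.BirchSwinnertonDyer.Rank1Residual.F1Sign2.ANg17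
open Summit.BirchSwinnertonDyer.Rank1Residual.F1Sign2.TranspositionDoor
open Summit.BirchSwinnertonDyer.BirchSwinnertonDyer.Theorems.RankOneAtTwoOneDoor
open scoped MatrixGroups ModularForm ComplexConjugate
open CongruenceSubgroup
open scoped Classical

/-! ## -an's reduction lemma (Sketch_g22 l.244–258, VERBATIM) -/

/-- AN-39e follows from the exponent law AN-39c₂ once the two Heegner points HAVE exponents (supplied on the slice by
Gross–Zagier–Kolyvagin: rank `E(Kᵢ) = 1`); recorded as the one-line reduction it is. [folklore]
REF1-AUDIT §201: CLEAN (kernel); it IS the reduction e ⇐ c₂ once both rows carry the same binders (they now do). -/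
theorem minimalRMGenusSum_exponents_zero {m₁ m₂ e : ℕ} {s r r' : ℤ}
    (h : s = 2 ^ (m₁ + m₂ + e) * r) (hr' : Odd r') (h' : s = 2 ^ e * r') : m₁ = 0 ∧ m₂ = 0 := by
  rcases Nat.eq_zero_or_pos (m₁ + m₂) with h0 | hpos
  · omega
  · exfalso
    obtain ⟨j, hj⟩ := hr'
    have hpow : (2 : ℤ) ^ (m₁ + m₂ + e) = 2 ^ e * (2 * 2 ^ (m₁ + m₂ - 1)) := by
      have hk : m₁ + m₂ + e = e + (1 + (m₁ + m₂ - 1)) := by omega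
      rw [hk, pow_add, pow_add, pow_one]
    have hne : (2 : ℤ) ^ e ≠ 0 := pow_ne_zero _ (by norm_num)
    have h3 : (2 : ℤ) ^ e * (2 * j + 1) = 2 ^ e * (2 * (2 ^ (m₁ + m₂ - 1) * r)) := by
      rw [← hj, ← h', h, hpow]; ring
    have h4 := mul_left_cancel₀ hne h3
    generalize (2 : ℤ) ^ (m₁ + m₂ - 1) * r = X at h4
    omega

/-! ## REF1 §201 — BC7 kernel lemmas (sorry-free)

(K1) `Int` division in AN-39i (`B / κ`) and AN-39j (`Odd (B / 4)`) is Lean's E-rounding (floor for positive divisors):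
harmless when `κ ∣ B` (AN-39g), junk otherwise; in particular for ODD `n`, `n² / 4 = (n² − 1)/4` is EVEN.
(K2) the `2`-adic decomposition `Σ = 2^a · odd` is unique, so AN-39c₂'s conclusion cannot hold for two parametrisation data whose
Heegner points differ by the factor `2` (the `c ↦ 2c` junk, K4) — nor survive a shift of `ord₂` by `2` (the `Ш(E)[2] = (ℤ/2)²` regime).
(K3) the exact constants of AN-39c/AN-39h cannot hold together with the `Ш`-corrected identity unless `n₁ n₂ = 0`.
(K4) `ModularParametrizationData` does not pin the constant `c`: modulo the degree bookkeeping (taken as the hypothesis `hdeg`,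
mathematically `deg([2] ∘ φ) = 4 · deg φ`), `(c, deg) ↦ (2c, 4·deg)` is again a datum for the SAME `W, f, L, uniformize`, and its
Heegner point is TWICE the original one — so every E-level statement reading a `2`-divisibility of `heegnerPointComplex Dt H`
without `IsOptimalDatum Dt` / `¬ 2 ∣ Dt.c` (AN-39c₂, AN-39e) is false as typed. -/

/-- (K1a) E-rounding of `Int` division (the semantics of `B / κ` in AN-39i/j). -/
theorem bc7_int_div_neg_seven_two : (-7 : ℤ) / 2 = -4 := by norm_num

/-- (K1b) `6 / 4 = 1` in `ℤ`: `padicValInt 2 (B / κ)` is junk when `κ ∤ B`. -/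
theorem bc7_int_div_six_four : (6 : ℤ) / 4 = 1 := by norm_num

/-- (K1c) For odd `n`, `n ^ 2 / 4 = k (k + 1)` is even: `Odd (n² / 4)` FAILS for every odd Heegner index (AN-39j's left side at a
curve with `B = n²`, i.e. `Ш_an(E) = 4`, `Δ < 0`). -/
theorem bc7_odd_sq_div_four (n : ℤ) (hn : Odd n) : ¬ Odd (n ^ 2 / 4) := by
  obtain ⟨k, rfl⟩ := hn
  have h : (2 * k + 1) ^ 2 / 4 = k * (k + 1) := by
    have h1 : (2 * k + 1) ^ 2 = 1 + (k * (k + 1)) * 4 := by ring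
    rw [h1, Int.add_mul_ediv_right _ _ (by norm_num : (4 : ℤ) ≠ 0)]
    norm_num
  rw [h, Int.not_odd_iff_even]
  exact Int.even_mul_succ_self k

/-- (K2a) Uniqueness of the `2`-adic decomposition `2 ^ a · odd`. -/
theorem bc7_two_pow_odd_inj {a b : ℕ} {r s : ℤ} (hr : Odd r) (hs : Odd s) (h : 2 ^ a * r = 2 ^ b * s) : a = b := by
  by_contra hne
  rcases Nat.lt_or_gt_of_ne hne with hlt | hlt
  · have hb : b = a + (b - a - 1) + 1 := by omega
    rw [hb, pow_add, pow_add, pow_one, mul_assoc, mul_assoc] at h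
    have h2 := mul_left_cancel₀ (pow_ne_zero a (two_ne_zero' ℤ)) h
    have : Even r := ⟨2 ^ (b - a - 1) * s, by rw [h2]; ring⟩
    exact (Int.not_even_iff_odd.mpr hr) this
  · have ha : a = b + (a - b - 1) + 1 := by omega
    rw [ha, pow_add, pow_add, pow_one, mul_assoc, mul_assoc] at h
    have h2 := mul_left_cancel₀ (pow_ne_zero b (two_ne_zero' ℤ)) h.symm
    have : Even s := ⟨2 ^ (a - b - 1) * r, by rw [h2]; ring⟩
    exact (Int.not_even_iff_odd.mpr hs) this

/-- (K2b) AN-39c₂'s conclusion for the data `Dt` (exponents `m₁, m₂`) and for the doubled datum (exponents `m₁ + 1, m₂ + 1`, K4) at the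
SAME f-intrinsic genus sum `Σ` are jointly contradictory. -/
theorem bc7_exponent_clash (s : ℤ) (m₁ m₂ e : ℕ) :
    ¬ ((∃ r : ℤ, Odd r ∧ s = 2 ^ (m₁ + m₂ + e) * r) ∧ (∃ r' : ℤ, Odd r' ∧ s = 2 ^ ((m₁ + 1) + (m₂ + 1) + e) * r')) := by
  rintro ⟨⟨r, hr, h⟩, ⟨r', hr', h'⟩⟩
  have := bc7_two_pow_odd_inj hr hr' (h.symm.trans h')
  omega

/-- (K2c) The `Ш(E)[2^∞] = 4` regime: a shift of `ord₂ Σ` by `2` is equally contradictory (`m₁ + m₂ + e` vs `m₁ + m₂ + e − 2`). -/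
theorem bc7_exponent_clash_sha (s : ℤ) (m e : ℕ) :
    ¬ ((∃ r : ℤ, Odd r ∧ s = 2 ^ (m + e + 2) * r) ∧ (∃ r' : ℤ, Odd r' ∧ s = 2 ^ (m + e) * r')) := by
  rintro ⟨⟨r, hr, h⟩, ⟨r', hr', h'⟩⟩
  have := bc7_two_pow_odd_inj hr hr' (h.symm.trans h')
  omega

/-- (K3) AN-39c/AN-39h's constant (`|Σ| = 2 i_f n₁ n₂`, resp. `B = 2 i_f n²`) against the `Ш`-corrected identity
(`Ш_an(E) · |Σ| = 2 i_f n₁ n₂` with `Ш_an(E) = 4`): both hold only if `n₁ n₂ = 0`. -/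
theorem bc7_sha_clash (S i n₁ n₂ : ℤ) (hi : i ≠ 0) (h4 : 4 * S = 2 * i * n₁ * n₂) (h1 : S = 2 * i * n₁ * n₂) :
    n₁ * n₂ = 0 := by
  have h0 : 2 * i * (n₁ * n₂) = 0 := by linarith
  rcases mul_eq_zero.mp h0 with h2i | h
  · exact absurd (mul_eq_zero.mp h2i) (by push Not; exact ⟨two_ne_zero, hi⟩)
  · exact h

/-- (K4a) The DOUBLED parametrisation datum `(c, deg) ↦ (2c, 4·deg)` — same `f`, Néron lattice, uniformisation; the only field not
re-derived here is the degree bookkeeping `deg_spec` for `[2] ∘ φ`, taken as the hypothesis `hdeg` (mathematically: the fibre of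
`[2] ∘ φ` over `P` is the disjoint union of the fibres of `φ` over the four halves of `P`). -/
def twiceDatum {W : WeierstrassCurve ℚ} {N : ℕ} [NeZero N] (Dt : ModularParametrizationData W N)
    (hdeg : {P : (W.baseChange ℂ).toAffine.Point |
      Nat.card {y : Y0 N // ∃ τ : ℍ, Y0.mk N τ = y ∧
        Dt.uniformize (((2 * Dt.c : ℤ) : ℂ) * eichlerIntegral Dt.f τ) = P} ≠ 4 * Dt.deg}.Finite) :
    ModularParametrizationData W N :=
  { Dt with
    c := 2 * Dt.c
    smul_periodLattice_le := fun z hz => by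
      have h := Dt.smul_periodLattice_le z hz
      have e : ((2 * Dt.c : ℤ) : ℂ) * z = (Dt.c : ℂ) * z + (Dt.c : ℂ) * z := by push_cast; ring
      rw [e]
      exact add_mem h h
    deg := 4 * Dt.deg
    deg_pos := by have := Dt.deg_pos; omega
    deg_spec := hdeg }

/-- (K4b) The doubled datum has constant `2c` (so it is EVEN: excluded by `¬ 2 ∣ Dt.c`, and by `IsOptimalDatum` when `Λ_W = c Λ_f`). -/
theorem twiceDatum_c {W : WeierstrassCurve ℚ} {N : ℕ} [NeZero N] (Dt : ModularParametrizationData W N) (hdeg) :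
    (twiceDatum Dt hdeg).c = 2 * Dt.c := rfl

/-- (K4c) Its modular parametrisation is `2 • φ`. -/
theorem twiceDatum_φ {W : WeierstrassCurve ℚ} {N : ℕ} [NeZero N] (Dt : ModularParametrizationData W N) (hdeg) (τ : ℍ) :
    (twiceDatum Dt hdeg).φ τ = 2 • Dt.φ τ := by
  show Dt.uniformize (((2 * Dt.c : ℤ) : ℂ) * eichlerIntegral Dt.f τ) = 2 • Dt.uniformize ((Dt.c : ℂ) * eichlerIntegral Dt.f τ)
  have e : ((2 * Dt.c : ℤ) : ℂ) * eichlerIntegral Dt.f τ =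
      (Dt.c : ℂ) * eichlerIntegral Dt.f τ + (Dt.c : ℂ) * eichlerIntegral Dt.f τ := by push_cast; ring
  rw [e, map_add, two_nsmul]

/-- (K4d) **The Heegner point of the doubled datum is twice the Heegner point**: `ModularParametrizationData W N` does not pin the
Heegner point's `2`-divisibility — AN-39c₂ `RMGenusSumExponentLawAtTwo` and AN-39e `MinimalRMGenusSumCertifiesTwoDoorsAtTwo`
(no `IsOptimalDatum`, no `¬ 2 ∣ Dt.c`) quantify over both data with the same f-intrinsic genus sum (K2b). -/
theorem heegnerPointComplex_twiceDatum {W : WeierstrassCurve ℚ} {N : ℕ} [NeZero N] (Dt : ModularParametrizationData W N) (hdeg)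
    {D : ℤ} (H : HeegnerDatum N D) :
    heegnerPointComplex (twiceDatum Dt hdeg) H = 2 • heegnerPointComplex Dt H := by
  simp only [heegnerPointComplex, twiceDatum_φ, Finset.smul_sum]

end Summit.BirchSwinnertonDyer.Rank1Residual.F1Sign2.ANg22
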